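import Mathlib
import HarnessLib
import Summits.HubbardSuperconductivity.HubbardSuperconductivity.Theses.LiebTwin
import Summits.HubbardSuperconductivity.HubbardSuperconductivity.Theorems.EnslavedA1gLowerSandwich
import Summits.HubbardSuperconductivity.HubbardSuperconductivity.Theorems.LiebTwinNoOnsiteODLROEtaVacuum

/-!
# Crux `NoOnsiteODLRO` (stmt-HubbardSuperconductivity-0933) — strict pair window ⇒ `η`-vacuum
# (registered stub `stub_etaVacuumOfStrictWindow`, census by-product B1)

Repulsive Hubbard torus `H = hubbardTorus 2 L 1 U` on `(ℤ/Lℤ)²`, `L` even, Yang's STAGGERED pair-lowering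
operator `η = etaLower torusStagger` (adjoint of `η† = etaRaise torusStagger`, `[H, η†] = U η†`).
Write `E(M, 0) = minEnergyOn H (szSector M 0)` for the bottom of the joint sector `(M electrons, S^z = 0)`.

* `etaLower_mulVec_eq_zero_of_window` — if `ψ` is a ground state of `H` in the sector `(N, 0)`, `N ≥ 2`, and
  the pair window is STRICT in the form `E(N,0) - U < E(N-2,0)`, then `η ψ = 0`: `ηψ` lies in the sector
  `(N-2, 0)` and `H ηψ = (E(N,0) - U) ηψ` (adjoint Yang relation), while `H ≥ E(N-2,0) > E(N,0) - U` there
  (variational principle). This is the tree's `etaLower_groundState_eq_zero_of_window`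
  (`LiebTwinNoOnsiteODLROEtaVacuum.lean`, hypothesis written as `0 < U - (E(N,0) - E(N-2,0))`), re-keyed to
  the hypothesis shape of the registered stub.
* `stub_etaVacuumOfStrictWindow` — the registered stub of the lead's skeleton, verbatim.

So under a strict window every sector ground state is a lowest-weight vector of Yang's pseudospin `SU(2)`;
this feeds the pseudospin ceiling on the on-site pair structure factor.

Sources: C. N. Yang, PRL 63 (1989) 2144, eqs. (4)–(6); S. C. Zhang, PRL 65 (1990) 120 (pseudospin `SU(2)`);
H. Tasaki, *Physics and Mathematics of Quantum Many-Body Systems* (2020) §2.1 (variational principle).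
All statements are folklore given the tree's Yang commutator; no definition is introduced.
-/

noncomputable section

namespace Summit.HubbardSuperconductivity.NoOnsiteODLRO.Pseudospin

open Matrix Finset
open Literature.Probability.LatticeModels Literature.MathematicalPhysics.QuantumLattice
open scoped ComplexOrder

/-- **The `η`-vacuum of the strict pair window** (explicit-hypothesis form). Let `L` be even, `ψ` a ground
state of `H = hubbardTorus 2 L 1 U` in the joint sector `(N, S^z = 0)` with `N ≥ 2`, and suppose the pair
window is strict, `E(N,0) - U < E(N-2,0)` where `E(M,0) = minEnergyOn H (szSector M 0)`. Then
`etaLower torusStagger *ᵥ ψ = 0`: `ηψ` lies in the sector `(N-2, 0)`, satisfies `H ηψ = (E(N,0) - U) ηψ`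
by the adjoint Yang relation `H η = η H - U η`, and `H ≥ E(N-2,0) > E(N,0) - U` on that sector.
Yang, PRL 63 (1989) 2144, eq. (6); Zhang, PRL 65 (1990) 120; Tasaki (2020) §2.1. [folklore] -/
theorem etaLower_mulVec_eq_zero_of_window {U : ℝ} {L : ℕ} (hL : Even L) {N : ℕ} (hN : 2 ≤ N)
    {ψ : Fock (Orb (FermionTorus 2 L))} (hψ : IsGroundStateInSector (hubbardTorus 2 L 1 U) N 0 ψ)
    (hw : (hubbardTorus 2 L 1 U).minEnergyOn (szSector (Λ := FermionTorus 2 L) N 0) - U <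
      (hubbardTorus 2 L 1 U).minEnergyOn (szSector (Λ := FermionTorus 2 L) (N - 2) 0)) :
    etaLower torusStagger *ᵥ ψ = 0 :=
  Summit.HubbardSuperconductivity.HubbardSuperconductivity.Theorems.NoOnsiteODLRO.Pseudospin.etaLower_groundState_eq_zero_of_window
    hL U hN hψ (by linarith)

/-- **Registered stub `stub_etaVacuumOfStrictWindow`** of crux `NoOnsiteODLRO`
(stmt-HubbardSuperconductivity-0933; census by-product B1, a helper of line `registered`, not a piece of
the composition): on the torus of even side, a strict pair window `E(N,0) - U < E(N-2,0)` forces every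
ground state of the joint sector `(N, S^z = 0)`, `N ≥ 2`, into the kernel of Yang's staggered `η`
(`etaLower_mulVec_eq_zero_of_window`). Yang, PRL 63 (1989) 2144; Zhang, PRL 65 (1990) 120. [folklore] -/
theorem stub_etaVacuumOfStrictWindow :
    ∀ (U : ℝ) (L : ℕ) [NeZero L], Even L → ∀ (N : ℕ) (ψ : Fock (Orb (FermionTorus 2 L))), 2 ≤ N →
      IsGroundStateInSector (hubbardTorus 2 L 1 U) N 0 ψ →
      (hubbardTorus 2 L 1 U).minEnergyOn (szSector (Λ := FermionTorus 2 L) N 0) - U <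
        (hubbardTorus 2 L 1 U).minEnergyOn (szSector (Λ := FermionTorus 2 L) (N - 2) 0) →
      etaLower torusStagger *ᵥ ψ = 0 :=
  fun _ _ _ hL _ _ hN hψ hw => etaLower_mulVec_eq_zero_of_window hL hN hψ hw

end Summit.HubbardSuperconductivity.NoOnsiteODLRO.Pseudospin

end
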